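import Mathlib.Analysis.Calculus.FDeriv.Mul
import Mathlib.Analysis.Calculus.Deriv.Inv
import Mathlib.Analysis.InnerProductSpace.PiL2
import HarnessLib

/-!
# Crux K2 `PoloidalWindowRigidity` (stmt-NavierStokesRegularity-19708), line `z_shock` — R3 inhabitant census: ROTATING PATTERNS (XII) —
# the TRANSPORT IDENTITY of the exterior `2×2` system: for `w = p + λ q` with `λ² = m·a` the combination `X w − (λ/a) Θ w` contains
# NO derivatives of `p, q` (approximate Riemann invariants à la John; algebraic core of census item F3)

`--supports stmt-NavierStokesRegularity-19708 --as helper` (leafhand-ns-poloidalwindowdoor-3 g9, cell decomp-ns, 2026-08-31).  Class-free,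
def-free, Mathlib only (pointwise calculus in `EuclideanSpace ℝ (Fin 2)`; the vector fields `X = D(·)[y]`, `Θ = D(·)[Jy]` enter only through
the directions `y`, `J y` at the point).  **No stub and no summit is closed by this file; Navier–Stokes regularity is NOT proved here (rung 0).**

WHY THIS FILE.  For a rotating profile (`ω² ΘΘΨ = Σᵢ∂ᵢ(γ(Ψ)∂ᵢΨ)`) parts II and V of this series put the equation in first-order form in the
radial/angular derivations `X`, `Θ`: with `a = γ∘Ψ`, `p = a·XΨ`, `q = ΘΨ`, `m = ω²|y|² − a`,

  `X p = Θ(m q)`  (`…RotatingProfileLogPolar.rotating_profile_equation_logpolar`),   `X q = Θ(p / a)`  (`…AngularMomentum.radial_angular_commute`).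

In the hyperbolic exterior (`m > 0`) this `2×2` system has characteristic speeds `±λ/a`, `λ = √(m a)`, but — being non-autonomous (`m` grows like
`ω²|y|²`) and quasilinear (`a = γ(Ψ)`) — no exact Riemann invariants.  John's device (1974 §2) is the APPROXIMATE invariant `w± = p ± λ q`: its
transport along the characteristic direction `X ∓ (λ/a)Θ` produces only ZEROTH-ORDER terms.  This file proves that algebraic fact pointwise, for
arbitrary differentiable `p, q, m, a, λ` satisfying the two first-order relations at the point and `λ² = m a` there:

* ★ `transport_identity` — `X(p + λq) − (λ/a)·Θ(p + λq) = (Θm + Xλ − (λ/a)Θλ)·q − λ·p·Θa / a²`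
  (all derivatives of `p` and `q` cancel; with `Θm = −Θa = −γ'(Ψ)q`, `Θa = γ'(Ψ) q` the right side is `q`·(genuinely-nonlinear terms) plus the
  GEOMETRIC source `(Xλ) q` carrying the growth of `m` — after John's normalisation the `r^{-1/2}` factor of census item F4);
* `transport_identity_neg` — the twin for `w₋ = p − λq` along `X + (λ/a)Θ` (apply the first to `−λ`).

The instantiation `p := γ(Ψ)XΨ`, `q := ΘΨ`, `λ := √((ω²|y|² − γ(Ψ))γ(Ψ))` in the exterior `|y| > √γhi/|ω|` is immediate from parts II/V and
is left to the file that builds the characteristics (F3).  [folklore] (John 1974 §2; Hörmander 1997 §4.2, approximate Riemann invariants)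
-/

noncomputable section

namespace Summit.NavierStokesRegularity.NavierStokesRegularity.Theorems.PoloidalWindowDoorPoloidalWindowRigidityZShockRotatingProfileTransport

-- the summit and its single sub-problem share the name (CONVENTIONS §1)
set_option linter.dupNamespace false

open Set Filter Topology

variable {p q m a lam : EuclideanSpace ℝ (Fin 2) → ℝ} {J : EuclideanSpace ℝ (Fin 2) → EuclideanSpace ℝ (Fin 2)}

/-- ★ **Transport identity for the approximate Riemann invariant `w₊ = p + λq`.**  At a point `y`, let `p, q, m, a, λ` be differentiable,
`a(y) ≠ 0`, `X p = Θ(m q)` and `X q = Θ(p/a)` at `y` (`X = D(·)(y)[y]`, `Θ = D(·)(y)[Jy]`), and `λ(y)² = m(y)a(y)`.  Then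
`X(p + λq) − (λ/a)Θ(p + λq) = (Θm + Xλ − (λ/a)Θλ)·q − λ·p·Θa/a²` at `y`: no derivative of `p` or `q` survives. [folklore] -/
theorem transport_identity (y : EuclideanSpace ℝ (Fin 2))
    (hp : DifferentiableAt ℝ p y) (hq : DifferentiableAt ℝ q y) (hm : DifferentiableAt ℝ m y)
    (ha : DifferentiableAt ℝ a y) (hlam : DifferentiableAt ℝ lam y) (ha0 : a y ≠ 0)
    (hXp : fderiv ℝ p y y = fderiv ℝ (fun y' => m y' * q y') y (J y))
    (hXq : fderiv ℝ q y y = fderiv ℝ (fun y' => p y' / a y') y (J y))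
    (hlam2 : lam y ^ 2 = m y * a y) :
    fderiv ℝ (fun y' => p y' + lam y' * q y') y y - lam y / a y * fderiv ℝ (fun y' => p y' + lam y' * q y') y (J y) =
      (fderiv ℝ m y (J y) + fderiv ℝ lam y y - lam y / a y * fderiv ℝ lam y (J y)) * q y
        - lam y * p y * fderiv ℝ a y (J y) / a y ^ 2 := by
  -- derivative of `w = p + λ q`
  have hw : HasFDerivAt (fun y' => p y' + lam y' * q y')
      (fderiv ℝ p y + (lam y • fderiv ℝ q y + q y • fderiv ℝ lam y)) y :=
    hp.hasFDerivAt.add (hlam.hasFDerivAt.mul hq.hasFDerivAt)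
  -- expand the two first-order relations
  have hmq : HasFDerivAt (fun y' => m y' * q y') (m y • fderiv ℝ q y + q y • fderiv ℝ m y) y :=
    hm.hasFDerivAt.mul hq.hasFDerivAt
  have hinv : HasFDerivAt (fun y' => (a y')⁻¹) ((-(a y ^ 2)⁻¹) • fderiv ℝ a y) y :=
    (hasDerivAt_inv ha0).comp_hasFDerivAt y ha.hasFDerivAt
  have hpa : HasFDerivAt (fun y' => p y' * (a y')⁻¹) (p y • ((-(a y ^ 2)⁻¹) • fderiv ℝ a y) + (a y)⁻¹ • fderiv ℝ p y) y :=
    hp.hasFDerivAt.mul hinv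
  rw [hmq.fderiv] at hXp
  simp only [div_eq_mul_inv] at hXq
  rw [hpa.fderiv] at hXq
  simp only [_root_.add_apply, _root_.smul_apply, smul_eq_mul] at hXp hXq
  rw [hw.fderiv]
  simp only [_root_.add_apply, _root_.smul_apply, smul_eq_mul]
  rw [hXp, hXq]
  have hm' : m y = lam y ^ 2 / a y := by
    rw [eq_div_iff ha0, hlam2]
  rw [hm']
  field_simp
  ring

/-- **Twin for `w₋ = p − λq`** along `X + (λ/a)Θ`: `X(p − λq) + (λ/a)Θ(p − λq) = (Θm − Xλ − (λ/a)Θλ)·q + λ·p·Θa/a²`. [folklore] -/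
theorem transport_identity_neg (y : EuclideanSpace ℝ (Fin 2))
    (hp : DifferentiableAt ℝ p y) (hq : DifferentiableAt ℝ q y) (hm : DifferentiableAt ℝ m y)
    (ha : DifferentiableAt ℝ a y) (hlam : DifferentiableAt ℝ lam y) (ha0 : a y ≠ 0)
    (hXp : fderiv ℝ p y y = fderiv ℝ (fun y' => m y' * q y') y (J y))
    (hXq : fderiv ℝ q y y = fderiv ℝ (fun y' => p y' / a y') y (J y))
    (hlam2 : lam y ^ 2 = m y * a y) :
    fderiv ℝ (fun y' => p y' - lam y' * q y') y y + lam y / a y * fderiv ℝ (fun y' => p y' - lam y' * q y') y (J y) =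
      (fderiv ℝ m y (J y) - fderiv ℝ lam y y - lam y / a y * fderiv ℝ lam y (J y)) * q y
        + lam y * p y * fderiv ℝ a y (J y) / a y ^ 2 := by
  have hneg : DifferentiableAt ℝ (fun y' => -lam y') y := hlam.neg
  have hlam2' : (fun y' => -lam y') y ^ 2 = m y * a y := by simp only [neg_sq]; exact hlam2
  have h := transport_identity (lam := fun y' => -lam y') y hp hq hm ha hneg ha0 hXp hXq hlam2'
  have hfun : (fun y' => p y' + (fun y' => -lam y') y' * q y') = fun y' => p y' - lam y' * q y' := by
    funext y'; ring
  rw [hfun] at h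
  have hdn : fderiv ℝ (fun y' => -lam y') y = -fderiv ℝ lam y := fderiv_neg
  simp only [hdn, _root_.neg_apply] at h
  have e1 : -lam y / a y * fderiv ℝ (fun y' => p y' - lam y' * q y') y (J y) =
      -(lam y / a y * fderiv ℝ (fun y' => p y' - lam y' * q y') y (J y)) := by ring
  rw [e1, sub_neg_eq_add] at h
  rw [h]
  ring

end Summit.NavierStokesRegularity.NavierStokesRegularity.Theorems.PoloidalWindowDoorPoloidalWindowRigidityZShockRotatingProfileTransport
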